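import Summits.Ventures.PercRepro.C026TwoTimesCF
import Summits.Ventures.PercRepro.C026ClassCapacity

/-!
# mine-3's class-level (2×) (CONJECTURE M3-CL2X) in the tree's vocabulary, and `CL ⟹ (2×)` (p5, gen 15)

mine-3 (memo §28 (6), INBOX 16:34Z): the classes are the cluster unions `W`; a source `S ∈ N²` sends its two
units to `W_a(S) = D ∪ A₁` and `W_b(S) = D ∪ B₁` (`classA`, `classB`: the closed `c`-cluster together with the open
component of the mark in `G − D` — the open cluster of `c` in the ball map's image, `cluster_ballFlip_eq`); the
capacity of a class `W` on the `a`-side is `#Y_a(W) = #{T ∈ ac|b : Com_c(T) = W}` (`= τ(W) · 2^{e(V ∖ W)}` by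
`card_cellAC_cluster_eq`). **CL** is the Hall condition of the two-unit assignment: for every pair of families
of classes, the sources whose two classes lie in the families are at most half the capacity of the families
(`ClassLevelTwoTimes`). It is a CONJECTURE (census-clean on every scope, 16:34Z (6)); the one theorem here is
**`twoTimes_of_classLevelTwoTimes`**: CL ⟹ (2×) (take both families to be all classes).
-/

namespace PercRepro

open Finset

namespace MultiGraph

section ClassLevel

variable {V E : Type*} (G : MultiGraph V E)

/-- mine-3's `a`-class of a source: `W_a(S) = D ∪ A₁`, the closed cluster of `c` together with the vertices
reached from `a` by open walks avoiding it (`= Com_c(Z_a(S))`, `cluster_ballFlip_eq`). -/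
def classA (ω : Config E) (a c : V) : Set V :=
  G.cluster ωᶜ c ∪ {v | G.ConnAvoid ω (G.cluster ωᶜ c) a v}

open Classical in
/-- **CONJECTURE M3-CL2X (class-level (2×))**, the Hall form: for all families `Ua`, `Ub` of classes,
`2·#{S ∈ N² : W_a(S) ∈ Ua, W_b(S) ∈ Ub} ≤ Σ_{W ∈ Ua} #Y_a(W) + Σ_{W ∈ Ub} #Y_b(W)`. -/
def ClassLevelTwoTimes [Fintype V] [Fintype E] (a b c : V) : Prop :=
  ∀ Ua Ub : Finset (Set V),
    2 * (univ.filter fun ω : Config E =>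
        G.NTwo ω a b c ∧ G.classA ω a c ∈ Ua ∧ G.classA ω b c ∈ Ub).card ≤
      (∑ W ∈ Ua, (univ.filter fun ω : Config E =>
          (G.Conn ω c a ∧ ¬ G.Conn ω c b) ∧ G.cluster ω c = W).card) +
        (∑ W ∈ Ub, (univ.filter fun ω : Config E =>
          (G.Conn ω c b ∧ ¬ G.Conn ω c a) ∧ G.cluster ω c = W).card)

variable {G}

open Classical in
/-- A cell count is the sum of its class capacities over all classes. -/
theorem card_cell_eq_sum_classes [Fintype V] [Fintype E] (p : Config E → Prop) [DecidablePred p]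
    (c : V) :
    (univ.filter p).card =
      ∑ W ∈ (univ : Finset (Set V)), (univ.filter fun ω : Config E => p ω ∧ G.cluster ω c = W).card := by
  rw [Finset.card_eq_sum_card_fiberwise (f := fun ω => G.cluster ω c) (t := univ)
    (fun _ _ => Finset.mem_univ _)]
  refine Finset.sum_congr rfl fun W _ => ?_
  congr 1
  ext ω
  simp only [Finset.mem_filter, Finset.mem_univ, true_and]

open Classical in
/-- **CL ⟹ (2×)**: with both families equal to all classes, the Hall condition is `2·#N² ≤ #ac|b + #bc|a`. -/
theorem twoTimes_of_classLevelTwoTimes [Fintype V] [Fintype E] {a b c : V}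
    (h : G.ClassLevelTwoTimes a b c) : G.TwoTimes a b c := by
  have h1 := h univ univ
  have h0 : (univ.filter fun ω : Config E => G.NTwo ω a b c).card ≤
      (univ.filter fun ω : Config E => G.NTwo ω a b c ∧
        G.classA ω a c ∈ (univ : Finset (Set V)) ∧ G.classA ω b c ∈ (univ : Finset (Set V))).card := by
    apply Finset.card_le_card
    intro ω hω
    simp only [Finset.mem_filter, Finset.mem_univ, true_and, and_true] at hω ⊢
    exact hω
  have e1 := card_cell_eq_sum_classes (G := G) (fun ω => G.Conn ω c a ∧ ¬ G.Conn ω c b) c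
  have e2 := card_cell_eq_sum_classes (G := G) (fun ω => G.Conn ω c b ∧ ¬ G.Conn ω c a) c
  unfold TwoTimes
  refine le_trans (le_trans (Nat.mul_le_mul_left 2 h0) h1) (le_of_eq ?_)
  refine congrArg₂ (· + ·) ?_ ?_
  · exact (Finset.sum_congr rfl fun W _ => rfl).trans e1.symm
  · exact (Finset.sum_congr rfl fun W _ => rfl).trans e2.symm

end ClassLevel

end MultiGraph

end PercRepro
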